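import Mathlib.Analysis.Calculus.BumpFunction.Normed
import Mathlib.Analysis.Calculus.BumpFunction.InnerProduct
import Mathlib.Analysis.Calculus.ContDiff.Convolution
import Mathlib.Analysis.SpecialFunctions.SmoothTransition
import Mathlib.Analysis.Calculus.Deriv.Slope
import Mathlib.Analysis.Calculus.Deriv.MeanValue
import Mathlib.MeasureTheory.Measure.Haar.NormedSpace
import Mathlib.MeasureTheory.Measure.Haar.Unique
import HarnessLib

/-!
# Smoothing the lift of a circle homeomorphism (analytic core of the Alexander trick with
# smooth interior)

Topic `Literature/Topology/PlaneTopology`. **Everything in this file is proved; no named fact is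
introduced.**

Let `φ : ℝ → ℝ` be continuous, monotone and `2π`-equivariant (`φ (θ + 2π) = φ θ + 2π`) — the
lift of an orientation-preserving continuous monotone degree-one self-map of the circle, e.g. of
a circle homeomorphism. We construct a one-parameter family of lifts
`LiftSmoothing.family φ : ℝ → ℝ → ℝ`, `(t, θ) ↦ Λₜ θ`, with

* `LiftSmoothing.contDiffOn_family` — `(t, θ) ↦ Λₜ θ` is `C^∞` on `{t < 1} × ℝ`;
* `LiftSmoothing.family_add_two_pi` — every `Λₜ` is `2π`-equivariant;
* `LiftSmoothing.family_of_le_half` — `Λₜ θ = θ + φ 0` (a rotation) for `t ≤ 1/2`;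
* `LiftSmoothing.deriv_family_pos`, `LiftSmoothing.strictMono_family` — for `0 ≤ t < 1` the map
  `Λₜ` is a strictly increasing diffeomorphism of `ℝ` with positive derivative
  (`LiftSmoothing.surjective_family`);
* `LiftSmoothing.tendstoUniformly_family` — `Λₜ → φ` uniformly on `ℝ` as `t → 1⁻`
  (`LiftSmoothing.abs_family_sub_le` is the quantitative form).

Construction: `Λₜ = δ(t) (θ + φ 0) + (1 - δ(t)) (φ ⋆ ρ_{1-t})(θ)`, the convolution of `φ` with
the normalised bump of width `1 - t` (smooth jointly in `(t, θ)` by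
`MeasureTheory.contDiffOn_convolution_right_with_param`), and a smooth weight `δ` equal to `1`
for `t ≤ 1/2`, to `1 - t` for `t ≥ 3/4`, with `0 < δ(t) ≤ 1` for `0 ≤ t < 1`: the convolution is
monotone with nonnegative derivative, so `∂_θ Λₜ ≥ δ(t) > 0`, and `|Λₜ - φ|` is bounded by
`δ(t) · sup |θ + φ 0 - φ θ| + (φ (θ + (1 - t)) - φ (θ - (1 - t)))`, which tends to `0` uniformly
by uniform continuity of `φ` (its difference with the identity is periodic).

This is the one-variable input of the extension of a circle homeomorphism to a homeomorphism of
the closed disc that is a diffeomorphism of the open disc, `(r, θ) ↦ (r, Λ_r θ)` in polar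
coordinates (sequel file). Folklore; the analogous statement with the harmonic extension is the
Radó–Kneser–Choquet theorem, and with the conformally natural extension it is Douady–Earle
(1986). Together with the Schoenflies theorem of the tree (`Schoenflies.lean`, Carathéodory's
method) that extension is the seam tool of the "smooth-domain seam" construction of smooth
structures on topological surfaces (the `n = 2` leaf of
`Literature.Topology.FourManifolds.exists_chartedSpace_isManifold_of_le_three`, seat 1 /
approach B: glue the standard structure of a planar disc to a given smooth structure along the
boundary of a smooth sublevel domain, without triangulating).

## References

* A. Hatcher, *The Kirby torus trick for surfaces*, arXiv:1312.3518 (2013/2022), §"Smoothing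
  0-handles" (isotopies of the disc fixing the boundary; context).
* A. Douady, C. J. Earle, *Conformally natural extension of homeomorphisms of the circle*, Acta
  Math. 157 (1986) 23–48 (a published smooth-interior extension).
-/

noncomputable section

open Set Filter MeasureTheory Function Metric
open scoped ContDiff Topology Convolution

namespace Literature.Topology.PlaneTopology

namespace LiftSmoothing

/-! ### The kernel -/

/-- A fixed smooth bump on `ℝ` centred at `0`, equal to `1` on `[-1/2, 1/2]` and supported in
`[-1, 1]`. [folklore] -/
def bump : ContDiffBump (0 : ℝ) := ⟨1 / 2, 1, by norm_num, by norm_num⟩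

/-- The normalised bump `ρ` (integral `1`, support the open unit ball). [folklore] -/
def ρ : ℝ → ℝ := bump.normed volume

/-- `ρ` is smooth. [folklore] -/
theorem contDiff_ρ {n : ℕ∞} : ContDiff ℝ n ρ := bump.contDiff_normed

/-- `ρ ≥ 0`. [folklore] -/
theorem ρ_nonneg (x : ℝ) : 0 ≤ ρ x := bump.nonneg_normed x

/-- `∫ ρ = 1`. [folklore] -/
theorem integral_ρ : ∫ x, ρ x = 1 := bump.integral_normed

/-- `ρ` vanishes outside the open unit ball. [folklore] -/
theorem ρ_eq_zero {x : ℝ} (hx : 1 ≤ |x|) : ρ x = 0 := by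
  have : x ∉ Function.support ρ := by
    rw [ρ, bump.support_normed_eq]
    simp only [mem_ball, dist_zero_right, Real.norm_eq_abs, not_lt]
    exact hx
  simpa [Function.mem_support] using this

/-- `ρ` is continuous. [folklore] -/
theorem continuous_ρ : Continuous ρ := bump.continuous_normed

/-- The scaled kernel `ρ_{1-t}(y) = (1 - t)⁻¹ ρ ((1 - t)⁻¹ y)` of width `1 - t`. [folklore] -/
def kernel (t y : ℝ) : ℝ := (1 - t)⁻¹ * ρ ((1 - t)⁻¹ * y)

/-- The kernel is nonnegative for `t ≤ 1`. [folklore] -/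
theorem kernel_nonneg {t : ℝ} (ht : t < 1) (y : ℝ) : 0 ≤ kernel t y :=
  mul_nonneg (inv_nonneg.2 (sub_pos.2 ht).le) (ρ_nonneg _)

/-- The kernel has integral `1` (for `t < 1`). [folklore] -/
theorem integral_kernel {t : ℝ} (ht : t < 1) : ∫ y, kernel t y = 1 := by
  have hε : 0 < 1 - t := sub_pos.2 ht
  unfold kernel
  rw [integral_const_mul, Measure.integral_comp_mul_left (fun y => ρ y) (1 - t)⁻¹, inv_inv,
    abs_of_pos hε, integral_ρ, smul_eq_mul, mul_one, inv_mul_cancel₀ hε.ne']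

/-- The kernel vanishes outside `[-(1 - t), 1 - t]`. [folklore] -/
theorem kernel_eq_zero {t y : ℝ} (ht : t < 1) (hy : 1 - t ≤ |y|) : kernel t y = 0 := by
  have hε : 0 < 1 - t := sub_pos.2 ht
  unfold kernel
  rw [ρ_eq_zero, mul_zero]
  rw [abs_mul, abs_of_pos (inv_pos.2 hε)]
  rwa [le_inv_mul_iff₀ hε, mul_one]

/-- The kernel is continuous in `y`. [folklore] -/
theorem continuous_kernel (t : ℝ) : Continuous (kernel t) :=
  continuous_const.mul (continuous_ρ.comp (continuous_const.mul continuous_id))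

/-- Where the kernel is nonzero, `|y| < 1 - t`. [folklore] -/
theorem abs_lt_of_kernel_ne_zero {t y : ℝ} (ht : t < 1) (h : kernel t y ≠ 0) : |y| < 1 - t :=
  not_le.1 fun h' => h (kernel_eq_zero ht h')

/-- The kernel has compact support (`t < 1`). [folklore] -/
theorem hasCompactSupport_kernel {t : ℝ} (ht : t < 1) : HasCompactSupport (kernel t) := by
  refine HasCompactSupport.intro (isCompact_Icc (a := -(1 - t)) (b := 1 - t)) fun u hu => ?_
  by_contra h
  have := abs_lt_of_kernel_ne_zero ht h
  rw [abs_lt] at this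
  exact hu ⟨this.1.le, this.2.le⟩

/-- The kernel is integrable (`t < 1`). [folklore] -/
theorem integrable_kernel {t : ℝ} (ht : t < 1) : Integrable (kernel t) :=
  (continuous_kernel t).integrable_of_hasCompactSupport (hasCompactSupport_kernel ht)

/-- The kernel is smooth jointly in `(t, y)` on `{t < 1} × ℝ`. [folklore] -/
theorem contDiffOn_kernel {n : ℕ∞} : ContDiffOn ℝ n ↿kernel (Iio 1 ×ˢ univ) := by
  have h1 : ContDiffOn ℝ n (fun q : ℝ × ℝ => (1 - q.1)⁻¹) (Iio 1 ×ˢ univ) :=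
    (contDiffOn_const.sub contDiffOn_fst).inv fun q hq => (sub_pos.2 (show q.1 < 1 from hq.1)).ne'
  exact h1.mul (contDiff_ρ.comp_contDiffOn (h1.mul contDiffOn_snd))

/-! ### The mollified lift -/

variable (φ : ℝ → ℝ)

/-- The mollified lift `(φ ⋆ ρ_{1-t})(θ)`. [folklore] -/
def moll (t θ : ℝ) : ℝ := (φ ⋆[ContinuousLinearMap.lsmul ℝ ℝ, volume] kernel t) θ

variable {φ}

/-- The mollified lift as an integral against the kernel: `∫ φ (θ - u) ρ_{1-t}(u) du`. [folklore] -/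
theorem moll_eq (t θ : ℝ) : moll φ t θ = ∫ u, φ (θ - u) * kernel t u := by
  rw [moll, convolution_eq_swap]
  rfl

/-- For continuous `φ`, the integrand `u ↦ φ (θ - u) ρ_{1-t}(u)` is integrable (`t < 1`): it is
continuous with compact support. [folklore] -/
theorem integrable_shift_mul_kernel (hφ : Continuous φ) {t : ℝ} (ht : t < 1) (θ : ℝ) :
    Integrable fun u => φ (θ - u) * kernel t u :=
  ((hφ.comp (continuous_const.sub continuous_id)).mul (continuous_kernel t)).integrable_of_hasCompactSupport
    ((hasCompactSupport_kernel ht).mul_left)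

/-- **Equivariance is preserved**: if `φ (θ + 2π) = φ θ + 2π` then the same holds for the
mollified lift (`t < 1`). [folklore] -/
theorem moll_add_two_pi (hφ : Continuous φ) (hφp : ∀ θ, φ (θ + 2 * Real.pi) = φ θ + 2 * Real.pi)
    {t : ℝ} (ht : t < 1) (θ : ℝ) :
    moll φ t (θ + 2 * Real.pi) = moll φ t θ + 2 * Real.pi := by
  rw [moll_eq, moll_eq]
  have h : ∀ u, φ (θ + 2 * Real.pi - u) * kernel t u =
      φ (θ - u) * kernel t u + 2 * Real.pi * kernel t u := fun u => by
    rw [show θ + 2 * Real.pi - u = (θ - u) + 2 * Real.pi by ring, hφp]; ring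
  simp_rw [h]
  rw [integral_add (integrable_shift_mul_kernel hφ ht θ) ((integrable_kernel ht).const_mul _),
    integral_const_mul, integral_kernel ht, mul_one]

/-- Comparison of the mollified lift with values of a monotone `φ` at the ends of the window
`[θ - (1-t), θ + (1-t)]` (`t < 1`). [folklore] -/
theorem le_moll_le (hφ : Continuous φ) (hφm : Monotone φ) {t : ℝ} (ht : t < 1) (θ : ℝ) :
    φ (θ - (1 - t)) ≤ moll φ t θ ∧ moll φ t θ ≤ φ (θ + (1 - t)) := by
  rw [moll_eq]
  have hconst : ∀ c : ℝ, ∫ u, c * kernel t u = c := fun c => by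
    rw [integral_const_mul, integral_kernel ht, mul_one]
  constructor
  · calc φ (θ - (1 - t)) = ∫ u, φ (θ - (1 - t)) * kernel t u := (hconst _).symm
      _ ≤ ∫ u, φ (θ - u) * kernel t u := by
          refine integral_mono ((integrable_kernel ht).const_mul _) (integrable_shift_mul_kernel hφ ht θ)
            fun u => ?_
          by_cases hk : kernel t u = 0
          · simp only [hk, mul_zero, le_refl]
          · have hu := abs_lt.1 (abs_lt_of_kernel_ne_zero ht hk)
            exact mul_le_mul_of_nonneg_right (hφm (by linarith)) (kernel_nonneg ht u)
  · calc ∫ u, φ (θ - u) * kernel t u ≤ ∫ u, φ (θ + (1 - t)) * kernel t u := by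
          refine integral_mono (integrable_shift_mul_kernel hφ ht θ) ((integrable_kernel ht).const_mul _)
            fun u => ?_
          by_cases hk : kernel t u = 0
          · simp only [hk, mul_zero, le_refl]
          · have hu := abs_lt.1 (abs_lt_of_kernel_ne_zero ht hk)
            exact mul_le_mul_of_nonneg_right (hφm (by linarith)) (kernel_nonneg ht u)
      _ = φ (θ + (1 - t)) := hconst _

/-- **Monotonicity is preserved** by mollification (`t < 1`). [folklore] -/
theorem monotone_moll (hφ : Continuous φ) (hφm : Monotone φ) {t : ℝ} (ht : t < 1) :
    Monotone (moll φ t) := by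
  intro θ₁ θ₂ h
  rw [moll_eq, moll_eq]
  exact integral_mono (integrable_shift_mul_kernel hφ ht θ₁) (integrable_shift_mul_kernel hφ ht θ₂)
    fun u => mul_le_mul_of_nonneg_right (hφm (by linarith)) (kernel_nonneg ht u)

/-- **Closeness**: `|(φ ⋆ ρ_{1-t})(θ) - φ θ| ≤ φ (θ + (1 - t)) - φ (θ - (1 - t))` for monotone `φ`
(`t < 1`). [folklore] -/
theorem abs_moll_sub_le (hφ : Continuous φ) (hφm : Monotone φ) {t : ℝ} (ht : t < 1) (θ : ℝ) :
    |moll φ t θ - φ θ| ≤ φ (θ + (1 - t)) - φ (θ - (1 - t)) := by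
  have hε : 0 ≤ 1 - t := (sub_pos.2 ht).le
  obtain ⟨h1, h2⟩ := le_moll_le hφ hφm ht θ
  have h3 : φ (θ - (1 - t)) ≤ φ θ := hφm (by linarith)
  have h4 : φ θ ≤ φ (θ + (1 - t)) := hφm (by linarith)
  rw [abs_le]
  constructor <;> linarith

/-- **Joint smoothness** of `(t, θ) ↦ (φ ⋆ ρ_{1-t})(θ)` on `{0 < t < 1} × ℝ` for locally integrable
(e.g. continuous) `φ`: a convolution with a smooth compactly supported kernel depending smoothly
on the parameter (`MeasureTheory.contDiffOn_convolution_right_with_param`). [folklore] -/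
theorem contDiffOn_moll (hφ : Continuous φ) {n : ℕ∞} :
    ContDiffOn ℝ n (fun q : ℝ × ℝ => moll φ q.1 q.2) (Ioo 0 1 ×ˢ univ) := by
  have hk : IsCompact (closedBall (0 : ℝ) 1) := isCompact_closedBall 0 1
  have hgs : ∀ p, ∀ x, p ∈ Ioo (0 : ℝ) 1 → x ∉ closedBall (0 : ℝ) 1 → kernel p x = 0 := by
    intro p x hp hx
    refine kernel_eq_zero hp.2 ?_
    rw [mem_closedBall, dist_zero_right, Real.norm_eq_abs, not_le] at hx
    linarith [hp.1]
  have hg : ContDiffOn ℝ n ↿kernel (Ioo (0 : ℝ) 1 ×ˢ univ) :=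
    contDiffOn_kernel.mono (prod_mono (fun p hp => hp.2) le_rfl)
  exact contDiffOn_convolution_right_with_param (ContinuousLinearMap.lsmul ℝ ℝ) isOpen_Ioo hk hgs
    hφ.locallyIntegrable hg

/-- Smoothness of `θ ↦ (φ ⋆ ρ_{1-t})(θ)` for fixed `t ∈ (0, 1)`. [folklore] -/
theorem contDiff_moll_right (hφ : Continuous φ) {t : ℝ} (ht : t ∈ Ioo (0 : ℝ) 1) {n : ℕ∞} :
    ContDiff ℝ n (moll φ t) := by
  have h := (contDiffOn_moll hφ (n := n)).comp_contDiff (f := fun θ : ℝ => (t, θ))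
    (contDiff_const.prodMk contDiff_id) fun _ => ⟨ht, mem_univ _⟩
  exact h

/-- The derivative of the mollified lift of a monotone function is nonnegative. [folklore] -/
theorem deriv_moll_nonneg (hφ : Continuous φ) (hφm : Monotone φ) {t : ℝ} (ht : t ∈ Ioo (0 : ℝ) 1)
    (θ : ℝ) : 0 ≤ deriv (moll φ t) θ :=
  (monotone_moll hφ hφm ht.2).deriv_nonneg

/-! ### The weight `δ` and the family of lifts -/

/-- The weight `δ(t) = 1 - S(4t - 2) t` with `S` the smooth transition: `δ = 1` for `t ≤ 1/2`,
`δ = 1 - t` for `t ≥ 3/4`, and `1 - t ≤ δ(t) ≤ 1` for `0 ≤ t`. [folklore] -/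
def δ (t : ℝ) : ℝ := 1 - Real.smoothTransition (4 * t - 2) * t

/-- `δ` is smooth. [folklore] -/
theorem contDiff_δ {n : ℕ∞} : ContDiff ℝ n δ :=
  contDiff_const.sub ((Real.smoothTransition.contDiff.comp
    ((contDiff_const.mul contDiff_id).sub contDiff_const)).mul contDiff_id)

/-- `δ(t) = 1` for `t ≤ 1/2`. [folklore] -/
theorem δ_of_le_half {t : ℝ} (ht : t ≤ 1 / 2) : δ t = 1 := by
  rw [δ, Real.smoothTransition.zero_of_nonpos (by linarith), zero_mul, sub_zero]

/-- `δ(t) = 1 - t` for `3/4 ≤ t`. [folklore] -/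
theorem δ_of_ge {t : ℝ} (ht : 3 / 4 ≤ t) : δ t = 1 - t := by
  rw [δ, Real.smoothTransition.one_of_one_le (by linarith), one_mul]

/-- `1 - t ≤ δ(t)` for `0 ≤ t`. [folklore] -/
theorem one_sub_le_δ {t : ℝ} (ht : 0 ≤ t) : 1 - t ≤ δ t := by
  rw [δ]
  have h1 := Real.smoothTransition.le_one (4 * t - 2)
  nlinarith

/-- `δ(t) ≤ 1` for `0 ≤ t`. [folklore] -/
theorem δ_le_one {t : ℝ} (ht : 0 ≤ t) : δ t ≤ 1 := by
  rw [δ]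
  have h1 := Real.smoothTransition.nonneg (4 * t - 2)
  nlinarith

/-- `0 < δ(t)` for `0 ≤ t < 1`. [folklore] -/
theorem δ_pos {t : ℝ} (ht0 : 0 ≤ t) (ht : t < 1) : 0 < δ t :=
  lt_of_lt_of_le (sub_pos.2 ht) (one_sub_le_δ ht0)

variable (φ)

/-- **The family of lifts** `Λₜ θ = δ(t) (θ + φ 0) + (1 - δ(t)) (φ ⋆ ρ_{1-t})(θ)`. [folklore] -/
def family (t θ : ℝ) : ℝ := δ t * (θ + φ 0) + (1 - δ t) * moll φ t θ

variable {φ}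

/-- For `t ≤ 1/2` the lift `Λₜ` is the rotation `θ ↦ θ + φ 0`. [folklore] -/
theorem family_of_le_half {t : ℝ} (ht : t ≤ 1 / 2) (θ : ℝ) : family φ t θ = θ + φ 0 := by
  rw [family, δ_of_le_half ht]; ring

/-- **Equivariance** of every `Λₜ` (`t < 1`). [folklore] -/
theorem family_add_two_pi (hφ : Continuous φ) (hφp : ∀ θ, φ (θ + 2 * Real.pi) = φ θ + 2 * Real.pi)
    {t : ℝ} (ht : t < 1) (θ : ℝ) :
    family φ t (θ + 2 * Real.pi) = family φ t θ + 2 * Real.pi := by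
  rw [family, family, moll_add_two_pi hφ hφp ht]; ring

/-- **Joint smoothness** of `(t, θ) ↦ Λₜ θ` on `{t < 1} × ℝ`. [folklore] -/
theorem contDiffOn_family (hφ : Continuous φ) {n : ℕ∞} :
    ContDiffOn ℝ n (fun q : ℝ × ℝ => family φ q.1 q.2) (Iio 1 ×ˢ univ) := by
  -- on `{t < 1/2} × ℝ` the map is `θ + φ 0`; on `{0 < t < 1} × ℝ` it is built from smooth pieces
  apply contDiffOn_of_locally_contDiffOn
  rintro ⟨t, θ⟩ ⟨ht, -⟩
  by_cases h : t < 1 / 2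
  · refine ⟨Iio (1 / 2) ×ˢ univ, isOpen_Iio.prod isOpen_univ, ⟨h, mem_univ _⟩, ?_⟩
    have heq : EqOn (fun q : ℝ × ℝ => family φ q.1 q.2) (fun q => q.2 + φ 0)
        ((Iio 1 ×ˢ univ) ∩ (Iio (1 / 2) ×ˢ univ)) := fun q hq => family_of_le_half (le_of_lt hq.2.1) q.2
    exact (contDiffOn_snd.add contDiffOn_const).congr heq
  · refine ⟨Ioo 0 1 ×ˢ univ, isOpen_Ioo.prod isOpen_univ, ⟨⟨by linarith, ht⟩, mem_univ _⟩, ?_⟩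
    have hsub : (Iio (1 : ℝ) ×ˢ (univ : Set ℝ)) ∩ (Ioo 0 1 ×ˢ univ) ⊆ Ioo 0 1 ×ˢ univ :=
      inter_subset_right
    refine ContDiffOn.mono ?_ hsub
    have hδ : ContDiffOn ℝ n (fun q : ℝ × ℝ => δ q.1) (Ioo 0 1 ×ˢ univ) :=
      (contDiff_δ.comp contDiff_fst).contDiffOn
    exact (hδ.mul (contDiffOn_snd.add contDiffOn_const)).add
      ((contDiffOn_const.sub hδ).mul (contDiffOn_moll hφ))

/-- Smoothness of `Λₜ` for fixed `t < 1`. [folklore] -/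
theorem contDiff_family_right (hφ : Continuous φ) {t : ℝ} (ht : t < 1) {n : ℕ∞} :
    ContDiff ℝ n (family φ t) :=
  (contDiffOn_family hφ (n := n)).comp_contDiff (f := fun θ : ℝ => (t, θ))
    (contDiff_const.prodMk contDiff_id) fun _ => ⟨ht, mem_univ _⟩

/-- **Positive derivative**: `δ(t) ≤ ∂_θ Λₜ` hence `0 < ∂_θ Λₜ θ` for `0 ≤ t < 1`. [folklore] -/
theorem deriv_family_pos (hφ : Continuous φ) (hφm : Monotone φ) {t : ℝ} (ht0 : 0 ≤ t) (ht : t < 1)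
    (θ : ℝ) : 0 < deriv (family φ t) θ := by
  by_cases h : t ≤ 1 / 2
  · have : family φ t = fun θ => θ + φ 0 := funext (family_of_le_half h)
    rw [this, deriv_add_const, deriv_id'']
    exact one_pos
  · have ht' : t ∈ Ioo (0 : ℝ) 1 := ⟨by linarith, ht⟩
    have hm : DifferentiableAt ℝ (moll φ t) θ :=
      ((contDiff_moll_right hφ ht' (n := 1)).differentiable (by simp)).differentiableAt
    have hderiv : deriv (family φ t) θ = δ t + (1 - δ t) * deriv (moll φ t) θ := by
      have h1 : HasDerivAt (fun θ : ℝ => θ + φ 0) 1 θ := (hasDerivAt_id θ).add_const _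
      have h2 : HasDerivAt (moll φ t) (deriv (moll φ t) θ) θ := hm.hasDerivAt
      have h3 : HasDerivAt (family φ t) (δ t * 1 + (1 - δ t) * deriv (moll φ t) θ) θ :=
        (h1.const_mul (δ t)).add (h2.const_mul (1 - δ t))
      rw [h3.deriv, mul_one]
    rw [hderiv]
    have h1 := δ_pos ht0 ht
    have h2 := δ_le_one ht0
    have h3 := deriv_moll_nonneg hφ hφm ht' θ
    nlinarith

/-- **`Λₜ` is strictly increasing** for `0 ≤ t < 1`. [folklore] -/
theorem strictMono_family (hφ : Continuous φ) (hφm : Monotone φ) {t : ℝ} (ht0 : 0 ≤ t) (ht : t < 1) :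
    StrictMono (family φ t) :=
  strictMono_of_deriv_pos fun θ => deriv_family_pos hφ hφm ht0 ht θ

/-- `Λₜ` is continuous for `t < 1`. [folklore] -/
theorem continuous_family (hφ : Continuous φ) {t : ℝ} (ht : t < 1) : Continuous (family φ t) :=
  (contDiff_family_right hφ ht (n := 0)).continuous

/-- **`Λₜ` is onto** `ℝ` for `0 ≤ t < 1` (continuous, and `Λₜ (θ + 2πk) = Λₜ θ + 2πk` is unbounded in
both directions). [folklore] -/
theorem surjective_family (hφ : Continuous φ) (hφp : ∀ θ, φ (θ + 2 * Real.pi) = φ θ + 2 * Real.pi)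
    {t : ℝ} (ht : t < 1) : Surjective (family φ t) := by
  have hc := continuous_family hφ ht (φ := φ)
  have hper : ∀ (k : ℕ) θ, family φ t (θ + 2 * Real.pi * k) = family φ t θ + 2 * Real.pi * k := by
    intro k
    induction k with
    | zero => intro θ; simp
    | succ k ih =>
        intro θ
        rw [Nat.cast_succ, mul_add, mul_one, ← add_assoc, family_add_two_pi hφ hφp ht, ih]
        ring
  have hper' : ∀ (k : ℕ) θ, family φ t (θ - 2 * Real.pi * k) = family φ t θ - 2 * Real.pi * k := by
    intro k θ
    have := hper k (θ - 2 * Real.pi * k)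
    rw [sub_add_cancel] at this
    linarith
  intro y
  -- values above and below `y`
  obtain ⟨k, hk⟩ := exists_nat_gt ((y - family φ t 0) / (2 * Real.pi))
  obtain ⟨k', hk'⟩ := exists_nat_gt ((family φ t 0 - y) / (2 * Real.pi))
  have hπ : 0 < 2 * Real.pi := by positivity
  have hup : y ≤ family φ t (0 + 2 * Real.pi * k) := by
    rw [hper, ]
    rw [div_lt_iff₀ hπ] at hk
    linarith
  have hdown : family φ t (0 - 2 * Real.pi * k') ≤ y := by
    rw [hper']
    rw [div_lt_iff₀ hπ] at hk'
    linarith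
  have hle : (0 : ℝ) - 2 * Real.pi * k' ≤ 0 + 2 * Real.pi * k := by
    have : (0 : ℝ) ≤ 2 * Real.pi * k := by positivity
    have : (0 : ℝ) ≤ 2 * Real.pi * k' := by positivity
    linarith
  obtain ⟨θ, -, hθ⟩ := intermediate_value_Icc hle hc.continuousOn ⟨hdown, hup⟩
  exact ⟨θ, hθ⟩

/-! ### Uniform convergence `Λₜ → φ` as `t → 1⁻` -/

/-- A continuous `2π`-periodic function takes at any point a value it takes on `[0, 2π]`.
[folklore] -/
theorem exists_mem_Icc_eq_of_periodic {g : ℝ → ℝ} (hgp : Function.Periodic g (2 * Real.pi)) (θ : ℝ) :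
    ∃ θ' ∈ Ico (0 : ℝ) (2 * Real.pi), g θ' = g θ ∧ ∃ n : ℤ, θ' = θ - n • (2 * Real.pi) := by
  have hπ : 0 < 2 * Real.pi := by positivity
  refine ⟨toIcoMod hπ 0 θ, by simpa using toIcoMod_mem_Ico hπ 0 θ, ?_, ⟨toIcoDiv hπ 0 θ, rfl⟩⟩
  rw [toIcoMod, hgp.sub_zsmul_eq]

/-- The difference `θ + φ 0 - φ θ` is bounded (it is continuous and `2π`-periodic). [folklore] -/
theorem exists_bound_sub (hφ : Continuous φ) (hφp : ∀ θ, φ (θ + 2 * Real.pi) = φ θ + 2 * Real.pi) :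
    ∃ B, ∀ θ, |θ + φ 0 - φ θ| ≤ B := by
  set g : ℝ → ℝ := fun θ => θ + φ 0 - φ θ with hg
  have hgc : Continuous g := (continuous_id.add continuous_const).sub hφ
  have hgp : Function.Periodic g (2 * Real.pi) := fun θ => by
    simp only [hg, hφp]; ring
  obtain ⟨B, hB⟩ := (isCompact_Icc (a := (0 : ℝ)) (b := 2 * Real.pi)).exists_bound_of_continuousOn
    hgc.continuousOn
  refine ⟨B, fun θ => ?_⟩
  obtain ⟨θ', hθ', hgθ, -⟩ := exists_mem_Icc_eq_of_periodic hgp θ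
  have := hB θ' (Ico_subset_Icc_self hθ')
  rw [Real.norm_eq_abs, hgθ] at this
  exact this

/-- **Uniform modulus**: for a continuous `2π`-equivariant `φ`, `φ (θ + ε) - φ (θ - ε) → 0`
uniformly in `θ` as `ε → 0⁺` (the difference `φ - id` is periodic, hence uniformly continuous).
[folklore] -/
theorem tendsto_osc (hφ : Continuous φ) (hφp : ∀ θ, φ (θ + 2 * Real.pi) = φ θ + 2 * Real.pi) :
    ∀ η > 0, ∃ ε₀ > 0, ∀ ε, 0 ≤ ε → ε < ε₀ → ∀ θ, φ (θ + ε) - φ (θ - ε) < η := by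
  intro η hη
  set ψ : ℝ → ℝ := fun θ => φ θ - θ with hψ
  have hψc : Continuous ψ := hφ.sub continuous_id
  have hψp : Function.Periodic ψ (2 * Real.pi) := fun θ => by
    simp only [hψ, hφp]; ring
  -- uniform continuity of `ψ` on the compact `[-1, 2π + 1]`
  set K : Set ℝ := Icc (-1) (2 * Real.pi + 1) with hK
  have hK : IsCompact K := isCompact_Icc
  have huc := hK.uniformContinuousOn_of_continuous hψc.continuousOn
  rw [Metric.uniformContinuousOn_iff] at huc
  obtain ⟨d, hd, hdK⟩ := huc (η / 2) (by positivity)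
  refine ⟨min (d / 2) (min 1 (η / 4)), lt_min (by positivity) (lt_min one_pos (by positivity)),
    fun ε hε0 hε θ => ?_⟩
  have hεd : 2 * ε < d := by
    have := lt_of_lt_of_le hε (min_le_left _ _); linarith
  have hε1 : ε < 1 := lt_of_lt_of_le hε ((min_le_right _ _).trans (min_le_left _ _))
  have hεη : ε < η / 4 := lt_of_lt_of_le hε ((min_le_right _ _).trans (min_le_right _ _))
  -- reduce `θ` to `[0, 2π)`
  obtain ⟨θ', hθ', -, n, hn⟩ := exists_mem_Icc_eq_of_periodic hψp θ
  have hshift : ∀ x, ψ (x - n • (2 * Real.pi)) = ψ x := fun x => hψp.sub_zsmul_eq n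
  have h1 : ψ (θ + ε) = ψ (θ' + ε) := by
    rw [hn, show θ - n • (2 * Real.pi) + ε = (θ + ε) - n • (2 * Real.pi) by ring, hshift]
  have h2 : ψ (θ - ε) = ψ (θ' - ε) := by
    rw [hn, show θ - n • (2 * Real.pi) - ε = (θ - ε) - n • (2 * Real.pi) by ring, hshift]
  have hmem1 : θ' + ε ∈ K := ⟨by linarith [hθ'.1], by linarith [hθ'.2]⟩
  have hmem2 : θ' - ε ∈ K := ⟨by linarith [hθ'.1], by linarith [hθ'.2]⟩
  have hdist : dist (θ' + ε) (θ' - ε) < d := by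
    rw [Real.dist_eq, show θ' + ε - (θ' - ε) = 2 * ε by ring, abs_of_nonneg (by linarith)]
    exact hεd
  have h3 := hdK _ hmem1 _ hmem2 hdist
  rw [Real.dist_eq] at h3
  have h4 : φ (θ + ε) - φ (θ - ε) = (ψ (θ + ε) - ψ (θ - ε)) + 2 * ε := by
    simp only [hψ]; ring
  rw [h4, h1, h2]
  linarith [(abs_lt.1 h3).2]

/-- **Quantitative closeness** of `Λₜ` to `φ` (`3/4 ≤ t < 1`). [folklore] -/
theorem abs_family_sub_le (hφ : Continuous φ) (hφm : Monotone φ) {t : ℝ} (ht0 : 3 / 4 ≤ t) (ht : t < 1)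
    {B : ℝ} (hB : ∀ θ, |θ + φ 0 - φ θ| ≤ B) (θ : ℝ) :
    |family φ t θ - φ θ| ≤ (1 - t) * B + (φ (θ + (1 - t)) - φ (θ - (1 - t))) := by
  have hδ : δ t = 1 - t := δ_of_ge ht0
  have hε : 0 ≤ 1 - t := (sub_pos.2 ht).le
  have hε1 : 1 - t ≤ 1 := by linarith
  have h1 : family φ t θ - φ θ = (1 - t) * (θ + φ 0 - φ θ) + t * (moll φ t θ - φ θ) := by
    rw [family, hδ]; ring
  rw [h1]
  have h2 := abs_moll_sub_le hφ hφm ht θ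
  have h3 := hB θ
  calc |(1 - t) * (θ + φ 0 - φ θ) + t * (moll φ t θ - φ θ)|
      ≤ |(1 - t) * (θ + φ 0 - φ θ)| + |t * (moll φ t θ - φ θ)| := abs_add_le _ _
    _ = (1 - t) * |θ + φ 0 - φ θ| + t * |moll φ t θ - φ θ| := by
        rw [abs_mul, abs_mul, abs_of_nonneg hε, abs_of_nonneg (show (0 : ℝ) ≤ t by linarith)]
    _ ≤ (1 - t) * B + 1 * (φ (θ + (1 - t)) - φ (θ - (1 - t))) :=
        add_le_add (mul_le_mul_of_nonneg_left h3 hε)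
          (mul_le_mul (by linarith) h2 (abs_nonneg _) zero_le_one)
    _ = (1 - t) * B + (φ (θ + (1 - t)) - φ (θ - (1 - t))) := by rw [one_mul]

/-- **Uniform convergence** `Λₜ → φ` as `t → 1⁻`: for every `η > 0` there is `t₀ < 1` with
`|Λₜ θ - φ θ| < η` for all `t ∈ (t₀, 1)` and all `θ`. [folklore] -/
theorem family_sub_lt (hφ : Continuous φ) (hφm : Monotone φ)
    (hφp : ∀ θ, φ (θ + 2 * Real.pi) = φ θ + 2 * Real.pi) {η : ℝ} (hη : 0 < η) :
    ∃ t₀ < 1, ∀ t ∈ Ioo t₀ 1, ∀ θ, |family φ t θ - φ θ| < η := by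
  obtain ⟨B, hB⟩ := exists_bound_sub hφ hφp
  have hB0 : 0 ≤ B := le_trans (abs_nonneg _) (hB 0)
  obtain ⟨ε₀, hε₀, hosc⟩ := tendsto_osc hφ hφp (η / 2) (by positivity)
  -- choose `t₀` with `1 - t₀ < ε₀` and `(1 - t₀) (B + 1) < η/2`
  refine ⟨max (3 / 4) (1 - min (ε₀ / 2) (η / (2 * (B + 1)))), ?_, fun t ht θ => ?_⟩
  · have : 0 < min (ε₀ / 2) (η / (2 * (B + 1))) := lt_min (by positivity) (by positivity)
    exact max_lt (by norm_num) (by linarith)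
  · have ht34 : 3 / 4 ≤ t := le_trans (le_max_left _ _) ht.1.le
    have ht1 : t < 1 := ht.2
    have hlt : 1 - t < min (ε₀ / 2) (η / (2 * (B + 1))) := by
      have := lt_of_le_of_lt (le_max_right _ _) ht.1
      linarith
    have hε : 0 ≤ 1 - t := (sub_pos.2 ht1).le
    have h1 := abs_family_sub_le hφ hφm ht34 ht1 hB θ
    have h2 : φ (θ + (1 - t)) - φ (θ - (1 - t)) < η / 2 :=
      hosc (1 - t) hε (lt_of_lt_of_le (lt_of_lt_of_le hlt (min_le_left _ _)) (by linarith)) θ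
    have h3 : (1 - t) * B < η / 2 := by
      have hlt' : 1 - t < η / (2 * (B + 1)) := lt_of_lt_of_le hlt (min_le_right _ _)
      calc (1 - t) * B ≤ (1 - t) * (B + 1) := by gcongr; linarith
        _ < η / (2 * (B + 1)) * (B + 1) := by gcongr
        _ = η / 2 := by field_simp
    linarith

end LiftSmoothing


end Literature.Topology.PlaneTopology
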